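import Mathlib.Algebra.Order.BigOperators.Ring.Finset
import Literature.Computability.Cryptography.StatisticalDistanceProofs
import HarnessLib

/-!
# Statistical distance: the Bhattacharyya coefficient and Le Cam's inequality

Layer `Literature/Computability/Cryptography`, one-definition-and-theorems companion of
`StatisticalDistance.lean` (`PMF.tvDist`) and `StatisticalDistanceProofs.lean`. Everything PROVED:

* `PMF.bcCoeff p q = ∑' a, √(p a · q a)` — the Bhattacharyya coefficient (affinity) of two
  probability mass functions, `0 ≤ BC ≤ 1`, symmetric (Bhattacharyya 1943);
* `PMF.tvDist_le_sqrt_one_sub_bcCoeff_sq` — **Le Cam's inequality** `Δ(p, q) ≤ √(1 − BC(p, q)²)`: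
  `|p − q| = |√p − √q|(√p + √q)`, Cauchy–Schwarz on every finite set
  (`Finset.sum_sq_le_sum_mul_sum_of_sq_le_mul`), `∑(√p ∓ √q)² = 2 ∓ 2BC`, then `tsum_le_of_sum_le`.

The consumer is `PeikertPerturbation.lean` (an exact formula for `BC(D_{L,s,c}, D_{L,s,c+2u})` of a
discrete Gaussian, whence `Δ ≤ √(1 − e^{-2π‖u‖²/s²})` for the hiding step of Peikert's classical
`GapSVP ≤ LWE` reduction; the hiding lemma itself is the tree's
`Peikert2009.toReal_toOuterMeasure_le_of_shift` / `toReal_toOuterMeasure_bind_le_of_shift` of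
`PeikertReduction.lean` and is NOT restated here). `PMF.bcCoeff` and the theorems are deliberate
dot-notation extensions of Mathlib's `PMF` namespace, exactly like the tree's `PMF.tvDist` (Mathlib
has no total variation, Hellinger or Bhattacharyya functional for `PMF` at the pinned version;
searched `bhattacharyya`, `hellinger`, `affinity`, `tvDist`).

## References

* A. Bhattacharyya, *On a measure of divergence between two statistical populations defined by
  their probability distributions*, Bull. Calcutta Math. Soc. 35 (1943), 99–109 (the coefficient).
* L. Le Cam, *Asymptotic Methods in Statistical Decision Theory*, Springer 1986, Ch. 4 (affinity
  versus total variation); the inequality is folklore.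
-/

noncomputable section

open scoped ENNReal

namespace PMF

variable {α : Type*}

/-! ### The Bhattacharyya coefficient and the statistical distance -/

/-- The **Bhattacharyya coefficient** (affinity) of two probability mass functions,
`BC(p, q) = ∑' a, √(p a · q a) ∈ [0, 1]`, as a real number. Deliberate dot-notation extension of
Mathlib's `PMF` namespace (no Mathlib counterpart at the pinned version), next to `PMF.tvDist`.
(Bhattacharyya 1943; the functional is standard.) [folklore] -/
def bcCoeff (p q : PMF α) : ℝ :=
  ∑' a, Real.sqrt ((p a).toReal * (q a).toReal)

/-- Termwise AM–GM for the Bhattacharyya summand: `√(p a · q a) ≤ (p a + q a)/2` (the tree's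
`Literature.Analysis.FluidPDE.sqrt_mul_le_add_half`, re-proved in two lines to keep the imports of
this layer light). [folklore] -/
theorem sqrt_toReal_mul_le (p q : PMF α) (a : α) :
    Real.sqrt ((p a).toReal * (q a).toReal) ≤ ((p a).toReal + (q a).toReal) / 2 := by
  rw [Real.sqrt_mul ENNReal.toReal_nonneg]
  nlinarith [sq_nonneg (Real.sqrt (p a).toReal - Real.sqrt (q a).toReal),
    Real.sq_sqrt (ENNReal.toReal_nonneg : 0 ≤ (p a).toReal),
    Real.sq_sqrt (ENNReal.toReal_nonneg : 0 ≤ (q a).toReal)]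

/-- The summand `a ↦ √(p a · q a)` of the Bhattacharyya coefficient is summable (comparison with
`(p a + q a)/2`). [folklore] -/
theorem summable_sqrt_toReal_mul (p q : PMF α) :
    Summable fun a => Real.sqrt ((p a).toReal * (q a).toReal) :=
  Summable.of_nonneg_of_le (fun _ => Real.sqrt_nonneg _) (sqrt_toReal_mul_le p q)
    ((p.summable_coe_toReal.add q.summable_coe_toReal).div_const 2)

/-- `0 ≤ BC(p, q)`. [folklore] -/
theorem bcCoeff_nonneg (p q : PMF α) : 0 ≤ p.bcCoeff q :=
  tsum_nonneg fun _ => Real.sqrt_nonneg _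

/-- `BC(p, q) ≤ 1` (termwise AM–GM and `∑ p = ∑ q = 1`). [folklore] -/
theorem bcCoeff_le_one (p q : PMF α) : p.bcCoeff q ≤ 1 := by
  calc p.bcCoeff q ≤ ∑' a, ((p a).toReal + (q a).toReal) / 2 :=
        (summable_sqrt_toReal_mul p q).tsum_le_tsum (sqrt_toReal_mul_le p q)
          ((p.summable_coe_toReal.add q.summable_coe_toReal).div_const 2)
    _ = 1 := by
        rw [tsum_div_const, p.summable_coe_toReal.tsum_add q.summable_coe_toReal, tsum_coe_toReal,
          tsum_coe_toReal]
        norm_num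

/-- `BC` is symmetric. [folklore] -/
theorem bcCoeff_comm (p q : PMF α) : p.bcCoeff q = q.bcCoeff p := by
  simp only [bcCoeff, mul_comm]

/-- **Statistical distance versus Bhattacharyya coefficient**: `Δ(p, q) ≤ √(1 − BC(p, q)²)`.
Proof: `|p − q| = |√p − √q| (√p + √q)`, Cauchy–Schwarz on every finite set,
`∑ (√p − √q)² = 2 − 2 BC`, `∑ (√p + √q)² = 2 + 2 BC`. (Le Cam; folklore.) [folklore] -/
theorem tvDist_le_sqrt_one_sub_bcCoeff_sq (p q : PMF α) :
    p.tvDist q ≤ Real.sqrt (1 - p.bcCoeff q ^ 2) := by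
  classical
  set b := p.bcCoeff q with hb
  have hf0 : ∀ a, 0 ≤ (p a).toReal := fun _ => ENNReal.toReal_nonneg
  have hg0 : ∀ a, 0 ≤ (q a).toReal := fun _ => ENNReal.toReal_nonneg
  have hb0 : 0 ≤ b := bcCoeff_nonneg p q
  have hb1 : b ≤ 1 := bcCoeff_le_one p q
  -- the two auxiliary series `(√p ∓ √q)²`
  set u : α → ℝ := fun a => (p a).toReal + (q a).toReal - 2 * Real.sqrt ((p a).toReal * (q a).toReal)
  set v : α → ℝ := fun a => (p a).toReal + (q a).toReal + 2 * Real.sqrt ((p a).toReal * (q a).toReal)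
  have hu_eq : ∀ a, u a = (Real.sqrt (p a).toReal - Real.sqrt (q a).toReal) ^ 2 := fun a => by
    simp only [u]
    rw [sub_sq, Real.sq_sqrt (hf0 a), Real.sq_sqrt (hg0 a), Real.sqrt_mul (hf0 a)]
    ring
  have hv_eq : ∀ a, v a = (Real.sqrt (p a).toReal + Real.sqrt (q a).toReal) ^ 2 := fun a => by
    simp only [v]
    rw [add_sq, Real.sq_sqrt (hf0 a), Real.sq_sqrt (hg0 a), Real.sqrt_mul (hf0 a)]
    ring
  have hu0 : ∀ a, 0 ≤ u a := fun a => (hu_eq a).symm ▸ sq_nonneg _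
  have hv0 : ∀ a, 0 ≤ v a := fun a => (hv_eq a).symm ▸ sq_nonneg _
  have hspq := summable_sqrt_toReal_mul p q
  have hsu : Summable u := (p.summable_coe_toReal.add q.summable_coe_toReal).sub (hspq.mul_left 2)
  have hsv : Summable v := (p.summable_coe_toReal.add q.summable_coe_toReal).add (hspq.mul_left 2)
  have htu : ∑' a, u a = 2 - 2 * b := by
    have h : ∑' a, u a = ∑' a, ((p a).toReal + (q a).toReal) -
        ∑' a, 2 * Real.sqrt ((p a).toReal * (q a).toReal) :=
      (p.summable_coe_toReal.add q.summable_coe_toReal).tsum_sub (hspq.mul_left 2)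
    rw [h, p.summable_coe_toReal.tsum_add q.summable_coe_toReal, tsum_coe_toReal, tsum_coe_toReal,
      tsum_mul_left, hb, bcCoeff]
    ring
  have htv : ∑' a, v a = 2 + 2 * b := by
    have h : ∑' a, v a = ∑' a, ((p a).toReal + (q a).toReal) +
        ∑' a, 2 * Real.sqrt ((p a).toReal * (q a).toReal) :=
      (p.summable_coe_toReal.add q.summable_coe_toReal).tsum_add (hspq.mul_left 2)
    rw [h, p.summable_coe_toReal.tsum_add q.summable_coe_toReal, tsum_coe_toReal, tsum_coe_toReal,
      tsum_mul_left, hb, bcCoeff]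
    ring
  -- Cauchy–Schwarz on every finite set
  have hfin : ∀ s : Finset α,
      ∑ a ∈ s, |(p a).toReal - (q a).toReal| ≤ 2 * Real.sqrt (1 - b ^ 2) := by
    intro s
    have hCS : (∑ a ∈ s, |(p a).toReal - (q a).toReal|) ^ 2 ≤ (∑ a ∈ s, u a) * ∑ a ∈ s, v a := by
      refine Finset.sum_sq_le_sum_mul_sum_of_sq_le_mul s (fun a _ => hu0 a) (fun a _ => hv0 a)
        (fun a _ => le_of_eq ?_)
      have h1 : (Real.sqrt (p a).toReal - Real.sqrt (q a).toReal) *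
          (Real.sqrt (p a).toReal + Real.sqrt (q a).toReal) = (p a).toReal - (q a).toReal := by
        nlinarith [Real.sq_sqrt (hf0 a), Real.sq_sqrt (hg0 a)]
      rw [sq_abs, hu_eq, hv_eq, ← mul_pow, h1]
    have hsu' : ∑ a ∈ s, u a ≤ 2 - 2 * b := htu ▸ hsu.sum_le_tsum s (fun a _ => hu0 a)
    have hsv' : ∑ a ∈ s, v a ≤ 2 + 2 * b := htv ▸ hsv.sum_le_tsum s (fun a _ => hv0 a)
    have hsq : (∑ a ∈ s, |(p a).toReal - (q a).toReal|) ^ 2 ≤ 4 * (1 - b ^ 2) := by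
      calc (∑ a ∈ s, |(p a).toReal - (q a).toReal|) ^ 2 ≤ (∑ a ∈ s, u a) * ∑ a ∈ s, v a := hCS
        _ ≤ (2 - 2 * b) * (2 + 2 * b) :=
            mul_le_mul hsu' hsv' (Finset.sum_nonneg fun a _ => hv0 a) (by linarith)
        _ = 4 * (1 - b ^ 2) := by ring
    have hS0 : 0 ≤ ∑ a ∈ s, |(p a).toReal - (q a).toReal| := Finset.sum_nonneg fun _ _ => abs_nonneg _
    have hR : Real.sqrt (1 - b ^ 2) ^ 2 = 1 - b ^ 2 := Real.sq_sqrt (by nlinarith)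
    nlinarith [Real.sqrt_nonneg (1 - b ^ 2)]
  have htsum : ∑' a, |(p a).toReal - (q a).toReal| ≤ 2 * Real.sqrt (1 - b ^ 2) :=
    (summable_abs_toReal_sub_toReal p q).tsum_le_of_sum_le hfin
  unfold tvDist
  linarith

end PMF

end
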